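import Mathlib
import Summits.Ventures.PercRepro2.RootCutTheorem

/-!
# The mark `o` alone behind an unmarked cut vertex: the typed one-far-mark rule (blind cell
PercRepro2, p3 g3, 2026-08-25; `proofs/P3-BRIDGE.md` §11.8)

CLASS (`CutFarO`): an unmarked vertex `c` is a cut vertex of the support `z ∪ F` separating the side
`VH ∋ b, a₁, a₂, a₃` from the side `VL ∋ o`.  The kernel `K₃` is LINEAR in the `o`-coordinates — each
of its eight terms carries exactly one `o`-factor, in the copy `x` (term 5), `y` (term 2) or `w`
(terms 1, 3, 4, 6, 7, 8) — and on the support the `o`-coordinates of a copy are those of `c` on the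
root side times the far-side bit `1[c ↔ o]` (`st_eq_gluedO`).  Hence `K₃ = 1[c ↔ o](w)·T_w +
1[c ↔ o](y)·T_y + 1[c ↔ o](x)·T_x` with `T_w + T_y + T_x = K₃` of the root-side instance in which
`c` is RENAMED `o` (`KB_gluedO`), and **`typedCount F z τ K₃(o, a₁, a₂, a₃, b) =
typedCount F_H z τ K₃(c, a₁, a₂, a₃, b) · #{o ∈ C_w(c)} · (inert)`** (`typedCount_eq_cutFarO`).
Row 2′TRI on the class follows from row 2′TRI on the smaller root-side instance
(`typedCount_nonneg_of_cutFarO`).  Own work; standard axioms.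
-/

namespace Summit.Ventures.PercRepro2

open UnionCluster

namespace CovForm

namespace RootBridge

open OneTyped TypedA3 Untouched TypedFactor Separated

/-! ## The states -/

section States

/-- The state of a copy when `o` alone sits beyond `c`: the root-side state with `c` in the role
of `o`, its `o`-coordinates multiplied by the far-side bit `g = 1[c ↔ o]`. -/
def gluedO (h : St) (g : Bool) : St := (h.q', h.Lo && g, h.Ho && g, h.Lb, h.Hb, h.L3, h.H3)

/-- The six terms of `KB` carrying the `o`-factor in the third copy. -/
def TwO (x y w : St) : ℤ :=
  pdB x * (qB y * (qB w * (sigB w.Lo w.Ho * sigB w.Lb w.Hb)))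
  - pdB x * (qB y * (qB w * (sigB w.L3 w.H3 * (uB w.Lo w.Ho * sigB w.Lb w.Hb))))
  - pdB x * ((qB y * sigB y.Lb y.Hb) * (qB w * sigB w.Lo w.Ho))
  + pdB x * ((qB y * sigB y.Lb y.Hb) * (qB w * (sigB w.L3 w.H3 * uB w.Lo w.Ho)))
  - pdB x * (qB y * (pdB w * (uB w.Lo w.Ho * uB w.Lb w.Hb)))
  + qB x * ((pdB y * uB y.Lb y.Hb) * (pdB w * uB w.Lo w.Ho))

/-- The term of `KB` carrying the `o`-factor in the second copy. -/
def TyO (x y w : St) : ℤ :=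
  qB x * ((pdB y * uB y.Lo y.Ho) * (qB w * (sigB w.L3 w.H3 * sigB w.Lb w.Hb)))

/-- The term of `KB` carrying the `o`-factor in the first copy. -/
def TxO (x y w : St) : ℤ :=
  - (pdB x * uB x.Lo x.Ho) * ((qB y * sigB y.Lb y.Hb) * (qB w * sigB w.L3 w.H3))

/-- `KB` is the sum of its `w`-, `y`- and `x`-terms. -/
lemma KB_eq_TO (x y w : St) : KB x y w = TwO x y w + TyO x y w + TxO x y w := by
  unfold KB TwO TyO TxO
  ring

/-- A far-side bit as an integer. -/
def indO (g : Bool) : ℤ := if g then 1 else 0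

/-- `σ_o` of a glued state. -/
lemma sigB_gluedO (h : St) (g : Bool) :
    sigB (gluedO h g).Lo (gluedO h g).Ho = sigB h.Lo h.Ho * indO g := by
  rcases h with ⟨q, lo, ho, lb, hb, l3, h3⟩
  cases lo <;> cases ho <;> cases g <;> simp [sigB, gluedO, indO, St.Lo, St.Ho]

/-- `1_{o ∈ U}` of a glued state. -/
lemma uB_gluedO (h : St) (g : Bool) :
    uB (gluedO h g).Lo (gluedO h g).Ho = uB h.Lo h.Ho * indO g := by
  rcases h with ⟨q, lo, ho, lb, hb, l3, h3⟩
  cases lo <;> cases ho <;> cases g <;> simp [uB, gluedO, indO, St.Lo, St.Ho]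

/-- **The kernel on glued states is linear in the far-side bits.** -/
theorem KB_gluedO (hx : St) (gx : Bool) (hy : St) (gy : Bool) (hw : St) (gw : Bool) :
    KB (gluedO hx gx) (gluedO hy gy) (gluedO hw gw) =
      TwO hx hy hw * indO gw + TyO hx hy hw * indO gy + TxO hx hy hw * indO gx := by
  unfold KB TwO TyO TxO
  simp only [sigB_gluedO, uB_gluedO]
  simp only [gluedO, qB, pdB, St.q', St.Lb, St.Hb, St.L3, St.H3]
  ring

end States

/-! ## The class, the states of the support and the rule -/

section Main

open Classical

variable {V : Type*} {E : Type*} [Fintype E] [DecidableEq E] {R : Type*} [Field R]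
  [LinearOrder R] [IsStrictOrderedRing R]
variable (ends : E → Sym2 V) (o a₁ a₂ a₃ b c : V)

/-- **`o` alone behind an unmarked cut vertex `c`**: the support graph `z ∪ F` splits into a side
`VH ∋ b, a₁, a₂, a₃` and a side `VL ∋ o` meeting only in `c`, no typed edge inside both sides,
`c` none of the five marks. -/
structure CutFarO (VL VH : Set V) (F : Finset E) (z : Config E) : Prop where
  split : ∀ e, zF F z e = true → e ∈ within ends VL ∨ e ∈ within ends VH
  cap : ∀ t, t ∈ VL → t ∈ VH → t = c
  noloop : ∀ e ∈ F, ¬ (e ∈ within ends VL ∧ e ∈ within ends VH)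
  cL : c ∈ VL
  cH : c ∈ VH
  bH : b ∈ VH
  a1H : a₁ ∈ VH
  a2H : a₂ ∈ VH
  a3H : a₃ ∈ VH
  oL : o ∈ VL
  bc : b ≠ c
  a1c : a₁ ≠ c
  a2c : a₂ ≠ c
  a3c : a₃ ≠ c
  oc : o ≠ c

omit [Fintype E] [LinearOrder R] [IsStrictOrderedRing R] in
/-- A configuration below `z ∪ F` has its open edges within a side. -/
lemma CutFarO.split_of_le {VL VH : Set V} {F : Finset E} {z : Config E}
    (h : CutFarO ends o a₁ a₂ a₃ b c VL VH F z) {x : Config E} (hx : x ≤ zF F z) :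
    ∀ e, x e = true → e ∈ within ends VL ∨ e ∈ within ends VH := fun e he =>
  h.split e (by have := hx e; rw [he] at this; exact Bool.eq_true_of_true_le this)

omit [Fintype E] [LinearOrder R] [IsStrictOrderedRing R] in
/-- **The state of a copy of the support**: the root-side state of the instance with `c` renamed
`o`, glued with the far-side bit `1[c ↔ o]`. -/
theorem st_eq_gluedO {VL VH : Set V} {F : Finset E} {z : Config E}
    (h : CutFarO ends o a₁ a₂ a₃ b c VL VH F z) {x : Config E} (hx : ∀ e, e ∉ F → x e = z e) :
    st ends o a₁ a₂ a₃ b x =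
      gluedO (st ends c a₁ a₂ a₃ b (withinRestr ends VH x))
        (decide (Conn ends (withinRestr ends VL x) c o)) := by
  have hsp := CutFarO.split_of_le ends o a₁ a₂ a₃ b c h (le_zF hx)
  have hsp' : ∀ e, x e = true → e ∈ within ends VH ∨ e ∈ within ends VL := fun e he =>
    (hsp e he).symm
  have hcap' : ∀ t, t ∈ VH → t ∈ VL → t = c := fun t h1 h2 => h.cap t h2 h1
  unfold st gluedO St.q' St.Lo St.Ho St.Lb St.Hb St.L3 St.H3
  have e1 := conn_side ends hsp' hcap' h.a2H h.a1H
  have e2 := conn_cross ends hsp' hcap' ⟨h.cH, h.cL⟩ h.a1H h.oL h.oc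
  have e3 := conn_cross ends hsp' hcap' ⟨h.cH, h.cL⟩ h.a2H h.oL h.oc
  have e4 := conn_side ends hsp' hcap' h.a1H h.bH
  have e5 := conn_side ends hsp' hcap' h.a2H h.bH
  have e6 := conn_side ends hsp' hcap' h.a1H h.a3H
  have e7 := conn_side ends hsp' hcap' h.a2H h.a3H
  rw [decide_eq_decide.mpr e1, decide_eq_decide.mpr e2, decide_eq_decide.mpr e3,
    decide_eq_decide.mpr e4, decide_eq_decide.mpr e5, decide_eq_decide.mpr e6,
    decide_eq_decide.mpr e7]
  · simp only [Bool.decide_and]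
  all_goals infer_instance

/-- The root-side kernel of the instance with `c` renamed `o`, read on the root side. -/
noncomputable def hKO (VH : Set V) (T : St → St → St → ℤ) : Config E → Config E → Config E → R :=
  fun x y w => ((T (st ends c a₁ a₂ a₃ b (withinRestr ends VH x))
    (st ends c a₁ a₂ a₃ b (withinRestr ends VH y)) (st ends c a₁ a₂ a₃ b (withinRestr ends VH w)) : ℤ) : R)

/-- The far-side kernel `1[o ∈ C(c)]` in the third copy. -/
noncomputable def lKOw (VL : Set V) : Config E → Config E → Config E → R :=
  fun _ _ w => ((indO (decide (Conn ends (withinRestr ends VL w) c o)) : ℤ) : R)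

/-- The far-side kernel `1[o ∈ C(c)]` in the second copy. -/
noncomputable def lKOy (VL : Set V) : Config E → Config E → Config E → R :=
  fun _ y _ => ((indO (decide (Conn ends (withinRestr ends VL y) c o)) : ℤ) : R)

/-- The far-side kernel `1[o ∈ C(c)]` in the first copy. -/
noncomputable def lKOx (VL : Set V) : Config E → Config E → Config E → R :=
  fun x _ _ => ((indO (decide (Conn ends (withinRestr ends VL x) c o)) : ℤ) : R)

omit [Fintype E] [LinearOrder R] [IsStrictOrderedRing R] in
/-- **`K₃` on the support** when `o` alone sits beyond `c`: the three-monomial form. -/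
theorem K3_eq_cutFarO {VL VH : Set V} {F : Finset E} {z : Config E}
    (h : CutFarO ends o a₁ a₂ a₃ b c VL VH F z) {x y w : Config E}
    (hx : ∀ e, e ∉ F → x e = z e) (hy : ∀ e, e ∉ F → y e = z e) (hw : ∀ e, e ∉ F → w e = z e) :
    (K3 ends o a₁ a₂ a₃ b x y w : R) =
      lKOw ends o c VL (restr (sideF ends VL F) z x) (restr (sideF ends VL F) z y)
          (restr (sideF ends VL F) z w) *
        hKO ends a₁ a₂ a₃ b c VH TwO (restr (sideF ends VH F) z x) (restr (sideF ends VH F) z y)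
          (restr (sideF ends VH F) z w) +
      lKOy ends o c VL (restr (sideF ends VL F) z x) (restr (sideF ends VL F) z y)
          (restr (sideF ends VL F) z w) *
        hKO ends a₁ a₂ a₃ b c VH TyO (restr (sideF ends VH F) z x) (restr (sideF ends VH F) z y)
          (restr (sideF ends VH F) z w) +
      lKOx ends o c VL (restr (sideF ends VL F) z x) (restr (sideF ends VL F) z y)
          (restr (sideF ends VL F) z w) *
        hKO ends a₁ a₂ a₃ b c VH TxO (restr (sideF ends VH F) z x) (restr (sideF ends VH F) z y)
          (restr (sideF ends VH F) z w) := by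
  rw [K3_eq_KB, st_eq_gluedO ends o a₁ a₂ a₃ b c h hx, st_eq_gluedO ends o a₁ a₂ a₃ b c h hy,
    st_eq_gluedO ends o a₁ a₂ a₃ b c h hw, KB_gluedO]
  unfold hKO lKOw lKOy lKOx
  rw [withinRestr_restr_eq ends VH hx, withinRestr_restr_eq ends VH hy,
    withinRestr_restr_eq ends VH hw, withinRestr_restr_eq ends VL hx,
    withinRestr_restr_eq ends VL hy, withinRestr_restr_eq ends VL hw]
  push_cast
  ring

omit [Fintype E] [DecidableEq E] [LinearOrder R] [IsStrictOrderedRing R] in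
/-- The root-side kernel `TwO + TyO + TxO` is `K₃` of the instance with `c` renamed `o`. -/
lemma hKO_add (VH : Set V) (x y w : Config E) :
    hKO ends a₁ a₂ a₃ b c VH TwO x y w + hKO ends a₁ a₂ a₃ b c VH TyO x y w +
      hKO ends a₁ a₂ a₃ b c VH TxO x y w =
      (K3 ends c a₁ a₂ a₃ b (withinRestr ends VH x) (withinRestr ends VH y)
        (withinRestr ends VH w) : R) := by
  unfold hKO
  rw [K3_eq_KB, KB_eq_TO]
  push_cast
  ring

omit [Fintype E] [LinearOrder R] [IsStrictOrderedRing R] in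
/-- The state of the root-side instance only sees the root side. -/
lemma st_sideO {VL VH : Set V} {F : Finset E} {z : Config E}
    (h : CutFarO ends o a₁ a₂ a₃ b c VL VH F z) {x : Config E} (hx : x ≤ zF F z) :
    st ends c a₁ a₂ a₃ b x = st ends c a₁ a₂ a₃ b (withinRestr ends VH x) := by
  have hsp := CutFarO.split_of_le ends o a₁ a₂ a₃ b c h hx
  have hsp' : ∀ e, x e = true → e ∈ within ends VH ∨ e ∈ within ends VL := fun e he =>
    (hsp e he).symm
  have hcap' : ∀ t, t ∈ VH → t ∈ VL → t = c := fun t h1 h2 => h.cap t h2 h1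
  unfold st
  rw [decide_eq_decide.mpr (conn_side ends hsp' hcap' h.a2H h.a1H),
    decide_eq_decide.mpr (conn_side ends hsp' hcap' h.a1H h.cH),
    decide_eq_decide.mpr (conn_side ends hsp' hcap' h.a2H h.cH),
    decide_eq_decide.mpr (conn_side ends hsp' hcap' h.a1H h.bH),
    decide_eq_decide.mpr (conn_side ends hsp' hcap' h.a2H h.bH),
    decide_eq_decide.mpr (conn_side ends hsp' hcap' h.a1H h.a3H),
    decide_eq_decide.mpr (conn_side ends hsp' hcap' h.a2H h.a3H)]

omit [LinearOrder R] [IsStrictOrderedRing R] in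
/-- The root-side count of `TwO + TyO + TxO` is the typed base of the instance with `c` renamed
`o`. -/
lemma count_hKO_add {VL VH : Set V} {F : Finset E} {z : Config E} (τ : E → ℕ)
    (h : CutFarO ends o a₁ a₂ a₃ b c VL VH F z) :
    typedCount (sideF ends VH F) z τ (hKO ends a₁ a₂ a₃ b c VH TwO : Config E → Config E → Config E → R) +
      typedCount (sideF ends VH F) z τ (hKO ends a₁ a₂ a₃ b c VH TyO) +
      typedCount (sideF ends VH F) z τ (hKO ends a₁ a₂ a₃ b c VH TxO) =
      typedCount (sideF ends VH F) z τ (K3 ends c a₁ a₂ a₃ b : Config E → Config E → Config E → R) := by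
  rw [← typedCount_add', ← typedCount_add']
  refine typedCount_congr_on_support _ z τ fun x y w hc _ => ?_
  have hBF : sideF ends VH F ⊆ F := Finset.filter_subset _ _
  have hle : ∀ v : Config E, (∀ e, e ∉ sideF ends VH F → v e = z e) → v ≤ zF F z := fun v hv =>
    le_zF fun e he => hv e fun hB => he (hBF hB)
  rw [hKO_add, K3_eq_KB, K3_eq_KB, st_sideO ends o a₁ a₂ a₃ b c h (hle x fun e he => (hc e he).1),
    st_sideO ends o a₁ a₂ a₃ b c h (hle y fun e he => (hc e he).2.1),
    st_sideO ends o a₁ a₂ a₃ b c h (hle w fun e he => (hc e he).2.2)]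

omit [LinearOrder R] [IsStrictOrderedRing R] in
/-- **THE TYPED ONE-FAR-MARK RULE for `o`**: `typedCount F z τ K₃(o, a₁, a₂, a₃, b) =
typedCount F_H z τ K₃(c, a₁, a₂, a₃, b) · #{o ∈ C_w(c)} · (inert count)`. -/
theorem typedCount_eq_cutFarO {VL VH : Set V} (F : Finset E) (z : Config E) (τ : E → ℕ)
    (hτ : ∀ e ∈ F, τ e = 1 ∨ τ e = 2) (h : CutFarO ends o a₁ a₂ a₃ b c VL VH F z) :
    typedCount F z τ (K3 ends o a₁ a₂ a₃ b : Config E → Config E → Config E → R) =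
      typedCount (sideF ends VH F) z τ (K3 ends c a₁ a₂ a₃ b : Config E → Config E → Config E → R) *
        typedCount (sideF ends VL F) z τ (lKOw ends o c VL) *
        typedCount (F \ (sideF ends VL F ∪ sideF ends VH F)) z τ (fun _ _ _ => (1 : R)) := by
  set A := sideF ends VL F with hA
  set B := sideF ends VH F with hB
  set C := F \ (A ∪ B) with hC
  have hAF : A ⊆ F := Finset.filter_subset _ _
  have hBF : B ⊆ F := Finset.filter_subset _ _
  have hAB : Disjoint A B := by
    rw [Finset.disjoint_left]
    intro e heA heB
    simp only [hA, hB, sideF, Finset.mem_filter] at heA heB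
    exact h.noloop e heA.1 ⟨heA.2, heB.2⟩
  have hABF : A ∪ B ⊆ F := Finset.union_subset hAF hBF
  have hAC : Disjoint A C := Finset.disjoint_of_subset_left Finset.subset_union_left Finset.disjoint_sdiff
  have hBC : Disjoint B C := Finset.disjoint_of_subset_left Finset.subset_union_right Finset.disjoint_sdiff
  have hF : A ∪ B ∪ C = F := Finset.union_sdiff_of_subset hABF
  have hτA : ∀ e ∈ A, τ e = 1 ∨ τ e = 2 := fun e he => hτ e (hAF he)
  have hker : typedCount F z τ (K3 ends o a₁ a₂ a₃ b : Config E → Config E → Config E → R) =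
      typedCount F z τ (fun x y w =>
        lKOw ends o c VL (restr A z x) (restr A z y) (restr A z w) *
            hKO ends a₁ a₂ a₃ b c VH TwO (restr B z x) (restr B z y) (restr B z w) +
          lKOy ends o c VL (restr A z x) (restr A z y) (restr A z w) *
            hKO ends a₁ a₂ a₃ b c VH TyO (restr B z x) (restr B z y) (restr B z w) +
          lKOx ends o c VL (restr A z x) (restr A z y) (restr A z w) *
            hKO ends a₁ a₂ a₃ b c VH TxO (restr B z x) (restr B z y) (restr B z w)) := by
    refine typedCount_congr_on_support F z τ fun x y w hc _ => ?_
    exact K3_eq_cutFarO ends o a₁ a₂ a₃ b c h (fun e he => (hc e he).1) (fun e he => (hc e he).2.1)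
      (fun e he => (hc e he).2.2)
  rw [hker, typedCount_add', typedCount_add']
  have h1 := typedCount_mul_three A B C hAB hAC hBC z τ (lKOw ends o c VL)
    (hKO ends a₁ a₂ a₃ b c VH TwO : Config E → Config E → Config E → R)
  have h2 := typedCount_mul_three A B C hAB hAC hBC z τ (lKOy ends o c VL)
    (hKO ends a₁ a₂ a₃ b c VH TyO : Config E → Config E → Config E → R)
  have h3 := typedCount_mul_three A B C hAB hAC hBC z τ (lKOx ends o c VL)
    (hKO ends a₁ a₂ a₃ b c VH TxO : Config E → Config E → Config E → R)
  rw [hF] at h1 h2 h3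
  rw [h1, h2, h3]
  have hy : typedCount A z τ (lKOy ends o c VL : Config E → Config E → Config E → R) =
      typedCount A z τ (lKOw ends o c VL) := by
    rw [← typedCount_swap23 A z τ hτA (lKOw ends o c VL)]
    rfl
  have hx : typedCount A z τ (lKOx ends o c VL : Config E → Config E → Config E → R) =
      typedCount A z τ (lKOw ends o c VL) := by
    rw [← typedCount_swap13 A z τ hτA (lKOw ends o c VL)]
    rfl
  have hsum := count_hKO_add (R := R) ends o a₁ a₂ a₃ b c τ h
  rw [← hB] at hsum
  rw [hy, hx]
  linear_combination (typedCount A z τ (lKOw ends o c VL : Config E → Config E → Config E → R) *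
    typedCount C z τ (fun _ _ _ => (1 : R))) * hsum

/-- **Row 2′TRI when `o` alone sits behind an unmarked cut vertex** follows from row 2′TRI on the
root-side instance with `c` renamed `o`. -/
theorem typedCount_nonneg_of_cutFarO {VL VH : Set V} (F : Finset E) (z : Config E) (τ : E → ℕ)
    (hτ : ∀ e ∈ F, τ e = 1 ∨ τ e = 2) (h : CutFarO ends o a₁ a₂ a₃ b c VL VH F z)
    (hH : 0 ≤ typedCount (sideF ends VH F) z τ
      (K3 ends c a₁ a₂ a₃ b : Config E → Config E → Config E → R)) :
    0 ≤ typedCount F z τ (K3 ends o a₁ a₂ a₃ b : Config E → Config E → Config E → R) := by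
  rw [typedCount_eq_cutFarO ends o a₁ a₂ a₃ b c F z τ hτ h]
  have hL : (0 : R) ≤ typedCount (sideF ends VL F) z τ (lKOw ends o c VL) := by
    refine typedCount_nonneg_of_nonneg _ _ _ fun x y w => ?_
    unfold lKOw indO
    split_ifs <;> simp
  have hI : (0 : R) ≤ typedCount (F \ (sideF ends VL F ∪ sideF ends VH F)) z τ
      (fun _ _ _ => (1 : R)) :=
    typedCount_nonneg_of_nonneg _ _ _ fun _ _ _ => zero_le_one
  exact mul_nonneg (mul_nonneg hH hL) hI

end Main

end RootBridge

end CovForm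

end Summit.Ventures.PercRepro2
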